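import Literature.MathematicalPhysics.QuantumFieldTheory.Balaban1983to89.B15Prop1ModelCarrier
import Literature.MathematicalPhysics.QuantumFieldTheory.Balaban1983to89.B16Ineq17BoxTorus

/-!
# `Balaban1983to89.B15Prop1BoxChartCarrier` — T. Bałaban, *Large field renormalization. I. The basic step of the 𝐑 operation*,
Commun. Math. Phys. **122** (1989) 175–202 [Balaban1989LargeFieldI] («[IV]»), **Proposition 1** p. 194, with
[Balaban1989LargeFieldII] («[LF-II]») (1.7)–(1.9) pp. 357–358 and p. 359: the Proposition-1 carrier of
`B15Prop1ModelCarrier` with its `B′`-SIDE AT PRINT'S OBJECTS — the gauge-fixed fields `B′` ARE the box-chart coordinates on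
the bonds of the rectangular parallelepiped `Λ ⊂ ℤ⁴` off the comb tree `G₀` (`B16Ineq19BoxChart.chartSet`, the free variables
of (1.2)), and the positivity input (1.9) of the p. 359 argument is DISCHARGED from (1.67) [10] on the torus and (1.8) on the
box — both PROVED in the tree (`B5Bounds167Lattice.ineq167`, `B16Eq18Proof.ineq18_box_vec`, knitted by p26's
`B16Ineq17BoxTorus.ineq19_chart_lattice`) — modulo the ONE located perturbation letter of p. 357, now stated against the
CONCRETE leading form `⟨B̃′, Δ_kB̃′⟩` of [10].

statement-level skeleton of published theorems with citation tags; proofs where landed; nothing here is a claim about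
the Yang–Mills mass gap

Cell pub-ymgap, HUMAN RULING D-0062 (Track A full width), seat `pub-ymgap-dag-n12-c` (R134 acceleration seat (a), strategy
s1 of DAG node N12 = [B15]; second product after `B15Prop1ModelCarrier` p451024 ∕ p452344).  PDFs held:
`paper:balaban1989-cmp122-large-field-i` (journal page = PDF page + 174), `paper:balaban1989-cmp122-large-field-ii` (journal
page = PDF page + 354; pp. 357–359 = PDF 3–5, text layer re-read by this seat 2026-08-26).

THE PRINT.  [LF-II] p. 357 foot – p. 358: *«The leading term in the expansion is the quadratic form with the background field
identically equal to 1. Replacing the minimizer in this form by the kᵗʰ minimizer defined on the whole lattice, and the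
function ζ₀ by the function identically equal to 1, we change the form by a quadratic form bounded by O(exp(−R_k)). Now
the leading quadratic form is equal to ⟨B′, Δ_kB′⟩ defined by (1.65), (1.66) [10]. Using the bound (1.67) [10] for this
form, we obtain ⟨H_{1,k}B′, Δ₁(ζ₀)H_{1,k}B′⟩ ≧ γ₀‖∂B′‖² − O(1)(M⁶R_kε_k + exp(−R_k))‖B′‖². (1.7) Consider the quadratic form
‖∂B′‖² on the fields B′ defined on Λ, and equal to 0 on bonds of the graph G₀. Using the fact that Λ is a rectangular
parallelepiped contained in a cube of the size 100M, and that G₀ determines the axial gauge in Λ, we obtain the inequality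
Σ_{b∈Λ}|B′(b)|² ≦ d(100M)^{d+1} Σ_{p∈Λ}|(∂B′)(p)|². (1.8) … The inequalities (1.7), (1.8) imply finally ⟨H_{1,k}B′,
Δ₁(ζ₀)H_{1,k}B′⟩ ≧ γ₀/(2d(100M)⁵)‖B′‖², (1.9) for g_k sufficiently small.»*  p. 359: *«Denote by P₀ the projection onto the
subspace of B′ satisfying the gauge condition B′↾_{G₀} = 0. By the inequality (1.9) the operator P₀H*_{1,k}Δ₁H_{1,k}P₀ is
positive, hence invertible on this subspace …»*  [IV] p. 192 (1.73): *«Λ … is also a union of M-cubes, and by the condition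
(i) it is a rectangular parallelepiped contained in a cube of the size 100M.»*

WHAT THIS FILE PROVES (Mathlib + `B15Prop1ModelCarrier` + `B16Ineq17BoxTorus`; no `sorry`, no `instance`, no `notation`, no
`… : Prop` fact; structures ∕ defs are model OBJECTS with bodies; axioms standard).
§1 `BoxFamily ι` — per instance `i`: the cube-size parameter `M i ≥ 1`, the parallelepiped `Λ_i = B16Eq18Proof.box (n i) (y i)
   ⊂ ℤ⁴` (sides `n i μ ≤ 100·M i`), the torus sizes `Mt i μ ≥ n i μ` of the unit lattice `T₁^{(k)}` containing it, the
   fine-step `nk i = L^k ≥ 1` of [10]'s form, and `D = dim 𝔤`.  **`BSpace B i := EuclideanSpace ℝ (chartSet (n i) (y i) D)`**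
   — THE `B′`-SPACE OF PRINT: real components of `B′(b)` on the bonds `b ⊂ Λ_i` off the comb tree `G₀`, with the `ℓ²` inner
   product (`‖x‖² = Σ_{b∈Λ}|B′(b)|²`, `norm_sq_eq_sqN`); the gauge condition is SOLVED by the chart, so `P₀ = 1`.
   `BoxChartDatum B Bd F` — the remaining p. 359 data (`r`, `H`, `Hst`, `Δ₁`, `dV`, `J`, `A`, `Cfg`, `chart`, `Reg`, `dev`,
   `AnExt` of `B15Prop1ModelCarrier.ChartDatum`, the fine-lattice side `F i` still abstract); `toChartDatum` — the
   `ChartDatum` with `M := B.M`, `P₀ := 1`.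
§2 **`ineq19_bspace`** — (1.9) AT EVERY `B′` OF THE CHART, `d = 4`, `γ₀ = (4/π²)⁶`:
   `B16Sect1Wilson.Ineq19 ⟨HB′, Δ₁HB′⟩ ‖B′‖² ((4/π²)⁶) 4 M` from the ONE perturbation letter of p. 357 against the concrete
   leading form `Q_k(B′) = Σ_a formDk nk Mt (torExt Mt B′ a)` (the zero-extended chart field on the torus, p26) and *«for g_k
   sufficiently small»*; BY NAME `B16Ineq17BoxTorus.ineq19_chart_lattice` ((1.67) [10] on the torus, r02, ∘ (1.8) on the box,
   p30 — PROVED, not assumed).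
§3 **`prop1Printed_boxChart`** — `B15.Prop1Printed (lfVarOfModel X.toChartDatum)`: Proposition 1 on the carrier whose
   `B′`-side is print's box chart, from §2 and the REMAINING located letters of `B15Prop1ModelCarrier.prop1Printed_lfVarOfModel`
   ((m2) `H*` adjoint to `H` with `‖H*‖ ≤ hst` — `‖H‖ ≤ hst` derived; (m3) Prop. 4 [15] Lipschitz data; (m4) current small on
   regular data; (m5) first variation (1.12); (d4) chart deviation; (x) analytic-extension clause; `g_k` small), via n12-c's
   `prop1Printed_lfVarOfModel_of_ineq19`.

HONEST SCOPE.  (i) The fine-lattice side is NOT constructed: `F i`, `H_{1,k}`, `H*_{1,k}`, `Δ₁(ζ₀)`, `(δ/δA)V`, `J_{k,Z}`, the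
function `A` and the orbit carrier stay data ∕ letters exactly as in `B15Prop1ModelCarrier` (HONEST SCOPE (i) there).  (ii) The
perturbation letter (identification of the leading form after the first-order expansion in `A₀` and the replacement of the
minimizer ∕ `ζ₀`, p. 357) is the located remainder of (1.9), as in rows B16.Eq1.7 ∕ 1.9 (`B16Ineq17Assembly`,
`B16Ineq17BoxTorus` HONEST SCOPE (b)).  (iii) `d = 4` (print); `Λ` with lower corner `y i` and comb tree as in `B16Eq18Proof`.
(iv) Non-vacuity of §2's letter: p26's `B16Ineq17BoxTorus.ineq19_chart_leading` (the unperturbed case `C = 0`).  NOT summit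
progress; count-neutral (`--supports` the (B)-side crux K1).
-/

noncomputable section

namespace Literature.MathematicalPhysics.QuantumFieldTheory.Balaban1983to89.B15Prop1BoxChartCarrier

open scoped RealInnerProductSpace
open Literature.MathematicalPhysics.QuantumFieldTheory.Balaban1983to89
open B15Prop1ModelCarrier B16Eq18Proof B16Ineq19BoxChart B16Ineq17BoxTorus B16Ineq111Gaussian

/-! ## §1 The box family, print's `B′`-space, and the datum with `P₀ = 1` -/

/-- **The parallelepipeds of a family of instances** (data + the printed side conditions): per instance `i` the cube-size
parameter `M i` ([IV] p. 177), the rectangular parallelepiped `Λ_i = box (n i) (y i) ⊂ ℤ⁴` with lower corner `y i` and sides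
`n i μ ≤ 100·M i` (*«contained in a cube of the size 100M»*), the sizes `Mt i μ ≥ n i μ` of the unit torus `T₁^{(k)}`
containing `Λ_i` (on which [10]'s form `⟨B′, Δ_kB′⟩` lives), the fine step `nk i = L^k ≥ 1` of that form, and `D = dim 𝔤`.
[cite: Balaban1989LargeFieldI, (1.73) p.192; Balaban1989LargeFieldII, (1.8) p.358] -/
structure BoxFamily (ι : Type) where
  /-- the cube-size parameter `M` -/
  M : ι → ℕ
  /-- the sides of `Λ_i` -/
  n : ι → Fin 4 → ℕ
  /-- the lower corner of `Λ_i` -/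
  y : ι → Fin 4 → ℤ
  /-- the sizes of the unit torus containing `Λ_i` -/
  Mt : ι → Fin 4 → ℕ
  /-- the fine step `L^k` of [10]'s form -/
  nk : ι → ℕ
  /-- `dim 𝔤` -/
  D : ℕ
  /-- `1 ≤ M` -/
  one_le_M : ∀ i, 1 ≤ M i
  /-- *«Λ … contained in a cube of the size 100M»* -/
  n_le : ∀ i μ, n i μ ≤ 100 * M i
  /-- `Λ_i` fits in the torus -/
  n_le_Mt : ∀ i μ, n i μ ≤ Mt i μ
  /-- `1 ≤ L^k` -/
  one_le_nk : ∀ i, 1 ≤ nk i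

/-- **PRINT'S `B′`-SPACE at instance `i`**: the real components `x(b, a)` of `B′(b)`, `b ⊂ Λ_i` a bond off the comb tree
`G₀`, `a : Fin D` an orthonormal coordinate of 𝔤 — the box chart of `B16Ineq19BoxChart` (*«∫dB′↾_Λ δ_{G₀}(B′) …»*, (1.2))
— with the `ℓ²` inner product (`EuclideanSpace`), so that `‖x‖² = Σ_{b∈Λ}|B′(b)|²`. [cite: Balaban1989LargeFieldII, (1.2)
p.357, (1.8) p.358] -/
abbrev BSpace {ι : Type} (B : BoxFamily ι) (i : ι) : Type :=
  EuclideanSpace ℝ (chartSet (B.n i) (B.y i) B.D)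

/-- **The p. 359 data over print's `B′`-space** — `B15Prop1ModelCarrier.ChartDatum` without the two fields the box family
fixes (`M := B.M`; `P₀ := 1`, the gauge condition being solved by the chart): chart radius `r`, and per boundary datum
`W : Bd i` the operators `H_{1,k}`, `H*_{1,k}`, `Δ₁(ζ₀)`, `(δ/δA)V`, the current `J_{k,Z}`, the function `A` of (1.77) in the
chart, the orbit carrier `Cfg` with its `W`-chart from the ball `‖B′‖ ≤ r i`, the regularity predicate, the deviation and the
analytic-extension clause. [cite: Balaban1989LargeFieldII, p.359 (proof of Proposition 1 [IV]); Balaban1989LargeFieldI,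
(1.77)–(1.78) p.194] -/
structure BoxChartDatum {ι : Type} (B : BoxFamily ι) (Bd F : ι → Type)
    [∀ i, NormedAddCommGroup (F i)] [∀ i, InnerProductSpace ℝ (F i)] where
  /-- the radius of the Proposition-4 chart -/
  r : ι → ℝ
  /-- `H_{1,k}` -/
  H : (i : ι) → Bd i → (BSpace B i →ₗ[ℝ] F i)
  /-- `H*_{1,k}` -/
  Hst : (i : ι) → Bd i → (F i →ₗ[ℝ] BSpace B i)
  /-- `Δ₁(ζ₀)` -/
  Δ₁ : (i : ι) → Bd i → (F i →ₗ[ℝ] F i)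
  /-- `(δ/δA)V` -/
  dV : (i : ι) → Bd i → F i → F i
  /-- `J_{k,Z}` -/
  J : (i : ι) → Bd i → F i
  /-- the function (1.77) in the chart -/
  A : (i : ι) → Bd i → BSpace B i → ℝ
  /-- the orbit carrier -/
  Cfg : ι → Type
  /-- the `W`-chart from the ball `‖B′‖ ≤ r i` (no gauge condition left: `P₀ = 1`) -/
  chart : (i : ι) → Bd i → (GaugeBall (LinearMap.id : BSpace B i →ₗ[ℝ] BSpace B i) (r i) ≃ Cfg i)
  /-- «|∂V_k − 1| < ε on Z ∩ Λᶜ» -/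
  Reg : (i : ι) → ℝ → Bd i → Prop
  /-- `sup_{p′∈Λ}|V_Λ(∂p′) − 1|` -/
  dev : (i : ι) → Cfg i → ℝ
  /-- the analytic-extension clause -/
  AnExt : (i : ι) → ℝ → Bd i → Prop

namespace BoxChartDatum

variable {ι : Type} {B : BoxFamily ι} {Bd F : ι → Type}
  [∀ i, NormedAddCommGroup (F i)] [∀ i, InnerProductSpace ℝ (F i)]

/-- The `ChartDatum` of `B15Prop1ModelCarrier` determined by a box-chart datum: cube size `M i` (as a real number) and
`P₀ = 1`. [cite: Balaban1989LargeFieldII, p.359 («Denote by P₀ the projection onto the subspace of B′ satisfying the gauge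
condition»)] -/
def toChartDatum (X : BoxChartDatum B Bd F) : ChartDatum ι Bd (BSpace B) F where
  M i := (B.M i : ℝ)
  r := X.r
  P₀ _ := LinearMap.id
  H := X.H
  Hst := X.Hst
  Δ₁ := X.Δ₁
  dV := X.dV
  J := X.J
  A := X.A
  Cfg := X.Cfg
  chart := X.chart
  Reg := X.Reg
  dev := X.dev
  AnExt := X.AnExt

/-- Unfolding: the cube size of the datum is `M i`. [cite: Balaban1989LargeFieldI, (1.78) p.194 (bookkeeping)] -/
theorem toChartDatum_M (X : BoxChartDatum B Bd F) (i : ι) : X.toChartDatum.M i = (B.M i : ℝ) := rfl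

/-- Unfolding: the gauge projection of the datum is the identity (the chart solves `B′↾_{G₀} = 0`).
[cite: Balaban1989LargeFieldII, p.359 (bookkeeping)] -/
theorem toChartDatum_P₀ (X : BoxChartDatum B Bd F) (i : ι) : X.toChartDatum.P₀ i = LinearMap.id := rfl

end BoxChartDatum

/-! ## §2 (1.9) at every `B′` of print's chart, from (1.67) ∘ (1.8) PROVED and the p. 357 perturbation letter -/

section Positivity

variable {ι : Type} (B : BoxFamily ι)

/-- `‖x‖² = Σ_{b∈Λ}Σ_a x(b,a)²` — the `ℓ²` norm of the chart IS r13's `sqN` (private plumbing). [folklore] -/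
private theorem norm_sq_eq_sqN (i : ι) (x : BSpace B i) : ‖x‖ ^ 2 = sqN x.ofLp := by
  rw [EuclideanSpace.norm_sq_eq, sqN]
  refine Finset.sum_congr rfl fun j _ => ?_
  rw [Real.norm_eq_abs, sq_abs]

/-- **(1.9) AT EVERY `B′` OF PRINT'S CHART** (`d = 4`, `γ₀ = (4/π²)⁶`): for any real-valued function `Q` of the chart field
(print: `Q(B′) = ⟨H_{1,k}B′, Δ₁(ζ₀)H_{1,k}B′⟩`) differing from the LEADING FORM of [10] of the zero-extended chart field,
`Σ_a formDk nk Mt (torExt Mt B′ a)`, by at most `C(M⁶R_kε_k + e^{−R_k})‖B′‖²` (the two perturbation steps of p. 357 as ONE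
letter), and `C(M⁶R_kε_k + e^{−R_k}) ≤ γ₀/(8(100M)⁵)` (*«for g_k sufficiently small»*):
`B16Sect1Wilson.Ineq19 (Q B′) ‖B′‖² ((4/π²)⁶) 4 M`.  BY NAME p26's `B16Ineq17BoxTorus.ineq19_chart_lattice` — (1.67) [10] on the
torus (r02's `B5Bounds167Lattice.ineq167`) ∘ (1.8) on the box (p30's `B16Eq18Proof.ineq18_box_vec`), both PROVED.
[cite: Balaban1989LargeFieldII, (1.7)–(1.9) pp.357–358; Balaban1984PropagatorsI, (1.67) p.29] -/
theorem ineq19_bspace [∀ i μ, NeZero (B.Mt i μ)] [∀ i, NeZero (B.nk i)] (i : ι) (Q : BSpace B i → ℝ) {C Rk εk : ℝ}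
    (hpert : ∀ x : BSpace B i,
      |Q x - ∑ a, B5Bounds167Lattice.formDk (B.nk i) (B.Mt i) (torExt (B.Mt i) x.ofLp a)| ≤
        C * ((B.M i : ℝ) ^ 6 * Rk * εk + Real.exp (-Rk)) * ‖x‖ ^ 2)
    (hgk : C * ((B.M i : ℝ) ^ 6 * Rk * εk + Real.exp (-Rk)) ≤ (4 / Real.pi ^ 2) ^ 6 / (8 * (100 * (B.M i : ℝ)) ^ 5))
    (x : BSpace B i) :
    B16Sect1Wilson.Ineq19 (Q x) (‖x‖ ^ 2) ((4 / Real.pi ^ 2) ^ 6) 4 (B.M i : ℝ) := by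
  have hpert' : ∀ x' : chartSet (B.n i) (B.y i) B.D → ℝ,
      |Q (WithLp.toLp 2 x') - ∑ a, B5Bounds167Lattice.formDk (B.nk i) (B.Mt i) (torExt (B.Mt i) x' a)| ≤
        C * ((B.M i : ℝ) ^ 6 * Rk * εk + Real.exp (-Rk)) * sqN x' := by
    intro x'
    have h := hpert (WithLp.toLp 2 x')
    rwa [norm_sq_eq_sqN] at h
  have e6 : (4 / Real.pi ^ 2) ^ (4 + 2) = (4 / Real.pi ^ 2) ^ 6 := by norm_num
  have hsmall : C * ((B.M i : ℝ) ^ 6 * Rk * εk + Real.exp (-Rk)) ≤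
      (4 / Real.pi ^ 2) ^ (4 + 2) / (2 * ((4 : ℕ) : ℝ) * (100 * (B.M i : ℝ)) ^ (4 + 1)) := by
    have e : (4 / Real.pi ^ 2) ^ 6 / (8 * (100 * (B.M i : ℝ)) ^ 5) =
        (4 / Real.pi ^ 2) ^ (4 + 2) / (2 * ((4 : ℕ) : ℝ) * (100 * (B.M i : ℝ)) ^ (4 + 1)) := by norm_num
    exact hgk.trans_eq e
  have h := ineq19_chart_lattice (B.Mt i) (B.one_le_M i) (B.n_le i) (by norm_num) (B.n_le_Mt i) (B.nk i)
    (B.one_le_nk i) (fun x' => Q (WithLp.toLp 2 x')) hpert' hsmall x.ofLp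
  rw [e6, ← norm_sq_eq_sqN] at h
  exact h

end Positivity

/-! ## §3 Proposition 1 on the carrier whose `B′`-side is print's chart -/

section Prop1

variable {ι : Type} {B : BoxFamily ι} {Bd F : ι → Type}
  [∀ i, NormedAddCommGroup (F i)] [∀ i, InnerProductSpace ℝ (F i)]

/-- **Proposition 1 [IV] — `B15.Prop1Printed` — on the carrier whose `B′`-side IS print's box chart**, with the positivity
input (1.9) DISCHARGED from (1.67) [10] ∘ (1.8) (§2) modulo the p. 357 perturbation letter against the concrete leading form
and *«g_k sufficiently small»*; the remaining hypotheses are the located letters of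
`B15Prop1ModelCarrier.prop1Printed_lfVarOfModel` on the fine-lattice side: `H*` adjoint to `H` with `‖H*‖ ≤ hst` (`‖H‖ ≤ hst`
derived, `B15Prop1Minimum.norm_le_of_adjoint`), Prop. 4 [15] (`dV 0 = 0`, `ℓ i`-Lipschitz on the ball `ρ i ≥ hst·r i`,
contraction smallness with `γ = (4/π²)⁶/(8·100⁵)`), the current small on `ε`-regular data, the first variation (1.12), the
chart deviation bound, the analytic-extension clause, `0 < r i`.  BY NAME: `prop1Printed_lfVarOfModel_of_ineq19` ∘
`ineq19_bspace`. [cite: Balaban1989LargeFieldI, Prop. 1 (1.78) p.194; Balaban1989LargeFieldII, (1.7)–(1.9) pp.357–358, p.359;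
Balaban1984PropagatorsI, (1.67) p.29; Balaban1985Variational, Prop. 4 p.293] -/
theorem prop1Printed_boxChart [∀ i μ, NeZero (B.Mt i μ)] [∀ i, NeZero (B.nk i)] (X : BoxChartDatum B Bd F)
    (hadj : ∀ i W (x : BSpace B i) (y : F i), ⟪X.H i W x, y⟫ = ⟪x, X.Hst i W y⟫)
    {C hst cJ a b : ℝ} (hhst : 0 ≤ hst) (hcJ : 0 ≤ cJ) (ha : 0 ≤ a) (hb : 0 ≤ b)
    {ℓ ρ eA Rk εk : ι → ℝ} (hℓ : ∀ i, 0 ≤ ℓ i) (hr : ∀ i, 0 < X.r i) (heA : ∀ i, 0 < eA i)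
    (hpert : ∀ i W (x : BSpace B i),
      |⟪X.H i W x, X.Δ₁ i W (X.H i W x)⟫ -
          ∑ a, B5Bounds167Lattice.formDk (B.nk i) (B.Mt i) (torExt (B.Mt i) x.ofLp a)| ≤
        C * ((B.M i : ℝ) ^ 6 * Rk i * εk i + Real.exp (-Rk i)) * ‖x‖ ^ 2)
    (hgk : ∀ i, C * ((B.M i : ℝ) ^ 6 * Rk i * εk i + Real.exp (-Rk i)) ≤
      (4 / Real.pi ^ 2) ^ 6 / (8 * (100 * (B.M i : ℝ)) ^ 5))
    (hHst : ∀ i W z, ‖X.Hst i W z‖ ≤ hst * ‖z‖) (hdV0 : ∀ i W, X.dV i W 0 = 0)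
    (hdV : ∀ i W (u v : F i), ‖u‖ ≤ ρ i → ‖v‖ ≤ ρ i → ‖X.dV i W u - X.dV i W v‖ ≤ ℓ i * ‖u - v‖)
    (hρ : ∀ i, hst * X.r i ≤ ρ i)
    (hsmall : ∀ i, (B.M i : ℝ) ^ 5 / ((4 / Real.pi ^ 2) ^ 6 / (8 * 100 ^ 5)) * hst * ℓ i * hst ≤ 1 / 2)
    (hA : ∀ i W (x δ : BSpace B i), HasDerivAt (fun s : ℝ => X.A i W (x + s • δ))
      (⟪δ, X.Hst i W (X.J i W)⟫ + ⟪δ, X.Hst i W (X.Δ₁ i W (X.H i W x))⟫ + ⟪δ, X.Hst i W (X.dV i W (X.H i W x))⟫) 0)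
    (hJ : ∀ i ε W, 0 < ε → X.Reg i ε W → ‖X.J i W‖ ≤ cJ * ε)
    (hdev : ∀ i ε W (bb : GaugeBall (LinearMap.id : BSpace B i →ₗ[ℝ] BSpace B i) (X.r i)), 0 < ε → X.Reg i ε W →
      X.dev i (X.chart i W bb) ≤ a * ‖(bb.1 : BSpace B i)‖ + b * (B.M i : ℝ) ^ 2 * ε)
    (hAn : ∀ i ε W, 0 < ε → ε ≤ eA i → X.Reg i ε W → X.AnExt i ε W) :
    B15.Prop1Printed (lfVarOfModel X.toChartDatum) := by
  have hγ₀ : 0 < (4 / Real.pi ^ 2) ^ 6 := by positivity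
  have hH : ∀ i W (x : BSpace B i), ‖X.H i W x‖ ≤ hst * ‖x‖ := fun i W x =>
    B15Prop1Minimum.norm_le_of_adjoint (X.H i W) (X.Hst i W) (hadj i W) hhst (hHst i W) x
  have h19 : ∀ i W (x : BSpace B i), X.toChartDatum.P₀ i x = x →
      B16Sect1Wilson.Ineq19 ⟪X.toChartDatum.H i W x, X.toChartDatum.Δ₁ i W (X.toChartDatum.H i W x)⟫ (‖x‖ ^ 2)
        ((4 / Real.pi ^ 2) ^ 6) 4 (X.toChartDatum.M i) :=
    fun i W x _ => ineq19_bspace B i (fun x => ⟪X.H i W x, X.Δ₁ i W (X.H i W x)⟫) (hpert i W) (hgk i) x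
  exact prop1Printed_lfVarOfModel_of_ineq19 X.toChartDatum (fun _ _ => rfl) (fun _ _ _ => rfl) hadj hγ₀ hhst hhst hcJ
    ha hb hℓ hr heA (fun i => show (1 : ℝ) ≤ (B.M i : ℝ) by exact_mod_cast B.one_le_M i) h19 hH hHst hdV0 hdV hρ hsmall hA hJ hdev hAn

end Prop1

end Literature.MathematicalPhysics.QuantumFieldTheory.Balaban1983to89.B15Prop1BoxChartCarrier

end
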